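import Mathlib
import HarnessLib

/-!
# Crux `DigitPolyUniformity` (stmt-QuantumAdvantage-1392), line `Sketch`, cycle 7 — Stub KMT-dyadic

Dyadic decomposition of the block-index range: for `h ≤ n` the range `[0, 2^(n-h))` is the disjoint
union of `{0}` and the dyadic shells `[2^(i-h), 2^(i+1-h))`, `h ≤ i < n`; for `h ≥ n` both the range
(`= {0}`) and the (empty) shell decomposition reduce to the single term `F 0`.  Hence
`Σ_{y < 2^(n−h)} F y = F 0 + Σ_{h ≤ i < n} Σ_{2^(i−h) ≤ y < 2^(i+1−h)} F y`.
-/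

noncomputable section

namespace Summit.QuantumAdvantage.DigitPolyUniformity.SketchLAR.KMT

open Finset

/-- **Stub KMT-Y (dyadic decomposition of the block index range).**
`Σ_{y<2^{n−h}} F(y) = F(0) + Σ_{h ≤ i < n} Σ_{2^{i−h} ≤ y < 2^{i+1−h}} F(y)` (for `h ≥ n` both sides are `F 0`).
[folklore] -/
theorem stub_kmt_dyadic (F : ℕ → ℝ) (h n : ℕ) :
    ∑ y ∈ range (2 ^ (n - h)), F y =
      F 0 + ∑ i ∈ Ico h n, ∑ y ∈ Ico (2 ^ (i - h)) (2 ^ (i + 1 - h)), F y := by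
  rcases le_or_gt h n with hle | hlt
  · induction n, hle using Nat.le_induction with
    | base => simp
    | succ n hle ih =>
      have hpow : 2 ^ (n - h) ≤ 2 ^ (n + 1 - h) := Nat.pow_le_pow_right (by norm_num) (by omega)
      rw [Finset.sum_Ico_succ_top hle, ← add_assoc, ← ih, Finset.range_eq_Ico, Finset.range_eq_Ico,
        Finset.sum_Ico_consecutive _ (Nat.zero_le _) hpow]
  · have h0 : n - h = 0 := by omega
    simp [h0, Finset.Ico_eq_empty_of_le hlt.le]

end Summit.QuantumAdvantage.DigitPolyUniformity.SketchLAR.KMT
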